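import Summits.CriticalPhenomena.PercolationContinuityZ3.Theorems.FK.UniquenessOfNonPercolation
import Summits.CriticalPhenomena.PercolationContinuityZ3.Theorems.FK.GibbsThetaSandwich
import Summits.CriticalPhenomena.PercolationContinuityZ3.Theorems.FK.FreeWiredCoincidence
import HarnessLib

/-!
# FK-continuity cell, FO-10a: `θ¹(p,q) = 0 ⇒ φ⁰_{p,q} = φ¹_{p,q}` — uniqueness of the random-cluster measure
# in the non-percolating wired phase, throughout the subcritical phase, and AT `p_c(q)` under `T_W(q)`
# (Grimmett 2006, Thm. (5.33)(a) and the remark after it, Conj. (5.34)(ii) "if"; ACCN 1988, Thm. A.2)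

Registered R73 (cell INBOX l.5522, 2026-08-23); registry row FO-10a-g335; label NPC-C (coordinator fk-4 g152).
Cell `fk-continuity` (bschramm), row FO-10a (domain-Markov + comparison layer over FO-06); support file
for the FK-continuity transplant (`--supports stmt-CriticalPhenomena-4575`); builds on p205010 (kernel
theorem, internal audit signed; external expert review pending). Pure proofs; no definitions, no named
facts, no sorries; general dimension `d`, `0 ≤ p ≤ 1`, `q ≥ 1`.

The `θ`-level form of `UniquenessOfNonPercolation.lean` (`φ¹_{p,q}(x ↔ ∞) = 0 ∀ x ⇒ φ⁰_{p,q} = φ¹_{p,q}`),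
through FO-10a's `FKGibbs.real_percolatesAt_eq_zero_of_thetaWired_eq_zero` (`θ¹(p,q) = 0 ⇒` no member of
the sandwich class percolates at any site, `GibbsThetaSandwich.lean`):

* `rcLimit_false_eq_rcLimit_true_of_thetaWired_eq_zero` — **Grimmett 2006, Thm. (5.33)(a) for a
  non-percolating wired phase [ACCN88, Thm. A.2]: `θ¹(p,q) = 0 ⇒ φ⁰_{p,q} = φ¹_{p,q}`**; the sandwich class
  `FKGibbs d p q` is then the singleton `{φ⁰_{p,q}}` (`fkGibbs_iff_eq_rcLimit_false_of_thetaWired_eq_zero`),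
  and the edge densities agree, `h⁰(p,q) = h¹(p,q)` (FO-07b's Thm. (4.63));
* `rcLimit_false_eq_rcLimit_true_of_lt_rcCriticalProb` — **"there exists a unique random-cluster measure
  throughout the subcritical phase"** `0 ≤ p < p_c(q)` (remark after Thm. (5.33); `𝒟_q ∩ [0, p_c(q)) = ∅`,
  p. 102: `rcCriticalProb_le_of_rcLimit_false_ne_rcLimit_true`);
* AT THE CRITICAL POINT (Conj. (5.34)(ii), the "if" direction, which is a theorem):
  `rcLimit_false_eq_rcLimit_true_of_fkContinuityWired` — **`T_W(q)` (`θ¹(p_c(q),q) = 0`) forces a UNIQUE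
  random-cluster measure at `p_c(q)`** and continuous edge densities there; equivalently phase coexistence
  `φ⁰_{p_c,q} ≠ φ¹_{p_c,q}` forces a discontinuous wired transition
  (`thetaWired_rcCriticalProb_pos_of_rcLimit_false_ne_rcLimit_true`, the mechanism of Thm. (7.33) at large `q`);
* the cell's seams (FO-01 `ContinuityTargets.lean`): **`T_W(q) ⟺ T_F(q) ∧ φ⁰_{p_c(q),q} = φ¹_{p_c(q),q}`**
  (`fkContinuityWired_iff_free_and_rcLimit_eq`) and **`T_U(q) ⟺ (T_F(q) ⇒ φ⁰_{p_c(q),q} = φ¹_{p_c(q),q})`**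
  (`fkTransferAtCritical_iff`): the transfer residual of the cell is EXACTLY uniqueness of the critical
  infinite-volume measure given free non-percolation (cf. Raoufi 2020, Question 4, for `q ∈ (1,2)`).

HONEST FRAMING: unconditional structure of GRC §5.3; nothing here decides `T_F(q)`, `T_W(q)` or the
uniqueness at `p_c(q)` for any `q > 1` — it relates them. For the class `R_{p,q}` of DLR measures the same
conclusions would follow from a "DLR ⇒ sandwich" lemma (Grimmett (4.31)/(4.33)), which the tree does not
hold; the statements are made for the cell's sandwich class `FKGibbs` and the box limits `rcLimit`.

## References

* G. Grimmett, *The Random-Cluster Model*, Springer 2006 (`book:grimmett2006-random-cluster-model`):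
  Thm. (4.63) [PDF p. 89]; §5.2 Thm. (5.16) and the paragraph after it (`𝒟_q ∩ [0,p_c(q)) = ∅`) [PDF pp. 101–102];
  §5.3 Thm. (5.33)(a), the remark after it, Conj. (5.34) [PDF p. 107]; Thm. (7.33) [PDF p. 192]. [Grimmett2006]
* M. Aizenman, J. T. Chayes, L. Chayes, C. M. Newman, J. Stat. Phys. 50 (1988) 1–40, Thm. A.2.
  [AizenmanChayesChayesNewman1988]
* A. Raoufi, Ann. Inst. H. Poincaré Probab. Statist. 56 (2020), Question 4. [Raoufi2020]
* H. Duminil-Copin, *Lectures on the Ising and Potts models on the hypercubic lattice*, PIMS–CRM Summer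
  School 2017 (Springer 2019), Exercise 15(1) ("Prove that for `p < p_c`, `φ¹_{p,q} = φ⁰_{p,q}`"). [DuminilCopin2019]
-/

noncomputable section

open MeasureTheory Set Filter
open scoped Topology ENNReal

namespace Summit.CriticalPhenomena.PercolationContinuityZ3.Theorems.FK

open Literature.Probability.Percolation Literature.Probability.LatticeModels
open Literature.Barriers.CriticalPhenomena

variable {d : ℕ} {p q : ℝ} {P P' : Measure (BondConfig (Site d))}

/-! ### `θ¹(p,q) = 0`: the wired phase does not percolate -/

/-- `θ¹(p,q) = 0` ⇒ `φ¹_{p,q}(x ↔ ∞) = 0` at every site (FO-10a's class statement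
`FKGibbs.real_percolatesAt_eq_zero_of_thetaWired_eq_zero` for `φ¹_{p,q}` itself).
[cite: Grimmett2006, Thm. (4.19)(c) eq. (4.21) with §5.1 (5.1)] -/
theorem rcLimit_true_percolatesAt_eq_zero_of_thetaWired_eq_zero (hp : p ∈ Set.Icc (0 : ℝ) 1) (hq : 1 ≤ q)
    (hθ : thetaWired d p q = 0) (x : Site d) : rcLimit d true p q (percolatesAt x) = 0 := by
  haveI := isProbabilityMeasure_rcLimit true p q (d := d)
  exact (measureReal_eq_zero_iff (measure_ne_top _ _)).1
    (((isBoxLimit_rcLimit true hp hq).fkGibbs hp hq).real_percolatesAt_eq_zero_of_thetaWired_eq_zero hp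
      (one_pos.trans_le hq) hθ x)

/-- **Grimmett 2006, Thm. (5.33)(a) for a non-percolating wired phase [ACCN88, Thm. A.2]: if
`θ¹(p,q) = 0` then `φ⁰_{p,q} = φ¹_{p,q}`** (`0 ≤ p ≤ 1`, `q ≥ 1`, every `d`).
[cite: Grimmett2006, Thm. (5.33)(a) and the remark after it (p. 107)] -/
theorem rcLimit_false_eq_rcLimit_true_of_thetaWired_eq_zero (hp : p ∈ Set.Icc (0 : ℝ) 1) (hq : 1 ≤ q)
    (hθ : thetaWired d p q = 0) : rcLimit d false p q = rcLimit d true p q :=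
  rcLimit_false_eq_rcLimit_true_of_forall_percolatesAt_eq_zero hp hq
    (rcLimit_true_percolatesAt_eq_zero_of_thetaWired_eq_zero hp hq hθ)

/-- `φ¹_{p,q} ≤ P'` on increasing local events when `θ¹(p,q) = 0`, for every sandwich measure `P'`.
[cite: Grimmett2006, Thm. (5.33)(a) and the remark after it] -/
theorem rcLimit_true_real_le_of_thetaWired_eq_zero (hp : p ∈ Set.Icc (0 : ℝ) 1) (hq : 1 ≤ q)
    (hθ : thetaWired d p q = 0) (hP' : FKGibbs d p q P') {A : Set (BondConfig (Site d))}
    {Λ : Finset (Site d)} (hA : IsUpperSet A) (hAΛ : DeterminedBy A ↑(edgesIn (zdGraph d) Λ)) :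
    (rcLimit d true p q).real A ≤ P'.real A :=
  rcLimit_true_real_le_of_forall_percolatesAt_eq_zero hp hq
    (rcLimit_true_percolatesAt_eq_zero_of_thetaWired_eq_zero hp hq hθ) hP' hA hAΛ

/-- When `θ¹(p,q) = 0` every measure of the sandwich class equals `φ⁰_{p,q}` (Grimmett's
`|W_{p,q}| = |R_{p,q}| = 1`, read on the cell's class `FKGibbs`). [cite: Grimmett2006, Thm. (5.33)(a) with Thm. (4.34) eq. (4.36)] -/
theorem FKGibbs.eq_rcLimit_false_of_thetaWired_eq_zero (hP : FKGibbs d p q P) (hp : p ∈ Set.Icc (0 : ℝ) 1)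
    (hq : 1 ≤ q) (hθ : thetaWired d p q = 0) : P = rcLimit d false p q :=
  hP.eq_rcLimit_of_rcLimit_false_eq_true hp hq (rcLimit_false_eq_rcLimit_true_of_thetaWired_eq_zero hp hq hθ)

/-- **Uniqueness at a non-percolating `p`**: `FKGibbs d p q P ↔ P = φ⁰_{p,q}` when `θ¹(p,q) = 0`.
[cite: Grimmett2006, Thm. (5.33)(a) and the remark after it] -/
theorem fkGibbs_iff_eq_rcLimit_false_of_thetaWired_eq_zero (hp : p ∈ Set.Icc (0 : ℝ) 1) (hq : 1 ≤ q)
    (hθ : thetaWired d p q = 0) : FKGibbs d p q P ↔ P = rcLimit d false p q := by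
  refine ⟨fun hP => hP.eq_rcLimit_false_of_thetaWired_eq_zero hp hq hθ, fun h => ?_⟩
  rw [h]
  exact (isBoxLimit_rcLimit false hp hq).fkGibbs hp hq

/-- Any two sandwich measures coincide when `θ¹(p,q) = 0`. [cite: Grimmett2006, Thm. (5.33)(a)] -/
theorem FKGibbs.eq_of_thetaWired_eq_zero (hP : FKGibbs d p q P) (hP' : FKGibbs d p q P')
    (hp : p ∈ Set.Icc (0 : ℝ) 1) (hq : 1 ≤ q) (hθ : thetaWired d p q = 0) : P = P' :=
  hP.eq_of_rcLimit_false_eq_true hP' hp hq (rcLimit_false_eq_rcLimit_true_of_thetaWired_eq_zero hp hq hθ)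

/-- The edge densities agree where the wired phase does not percolate: `h⁰(p,q) = h¹(p,q)` (FO-07b's
Thm. (4.63) `(a) ⇒ (c)`), i.e. `p ∉ 𝒟_q`. [cite: Grimmett2006, Thm. (4.63) with Thm. (5.33)(a)] -/
theorem freeEdgeDensity_eq_wiredEdgeDensity_of_thetaWired_eq_zero (hp : p ∈ Set.Icc (0 : ℝ) 1)
    (hq : 1 ≤ q) (hθ : thetaWired d p q = 0) {e : Sym2 (Site d)} (he : e ∈ (zdGraph d).edgeSet) :
    freeEdgeDensity d p q e = wiredEdgeDensity d p q e :=
  edgeDensity_eq_of_rcLimit_false_eq_rcLimit_true hp hq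
    (rcLimit_false_eq_rcLimit_true_of_thetaWired_eq_zero hp hq hθ) he

/-- Contrapositive: **phase coexistence forces wired percolation** — if `φ⁰_{p,q} ≠ φ¹_{p,q}` then
`θ¹(p,q) > 0`. [cite: Grimmett2006, Thm. (5.33)(a) and Conj. (5.34)] -/
theorem thetaWired_pos_of_rcLimit_false_ne_rcLimit_true (hp : p ∈ Set.Icc (0 : ℝ) 1) (hq : 1 ≤ q)
    (hne : rcLimit d false p q ≠ rcLimit d true p q) : 0 < thetaWired d p q :=
  lt_of_le_of_ne (thetaWired_nonneg d p q)
    fun h => hne (rcLimit_false_eq_rcLimit_true_of_thetaWired_eq_zero hp hq h.symm)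

/-! ### The subcritical phase `0 ≤ p < p_c(q)` -/

/-- **"There exists a unique random-cluster measure throughout the subcritical phase"**: for
`0 ≤ p < p_c(q)` (`q ≥ 1`), `φ⁰_{p,q} = φ¹_{p,q}` (Duminil-Copin's lecture notes leave this as Exercise 15(1)).
[cite: Grimmett2006, remark after Thm. (5.33) (p. 107)] [cite: DuminilCopin2019, Exercise 15(1)] -/
theorem rcLimit_false_eq_rcLimit_true_of_lt_rcCriticalProb (hq : 1 ≤ q) (hp0 : 0 ≤ p)
    (hlt : p < rcCriticalProb d q) : rcLimit d false p q = rcLimit d true p q :=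
  rcLimit_false_eq_rcLimit_true_of_thetaWired_eq_zero ⟨hp0, hlt.le.trans (rcCriticalProb_mem_Icc d q).2⟩ hq
    (thetaWired_eq_zero_of_lt_rcCriticalProb hq hp0 hlt)

/-- In the subcritical phase the sandwich class is the singleton `{φ⁰_{p,q}}`.
[cite: Grimmett2006, remark after Thm. (5.33) (p. 107)] -/
theorem fkGibbs_iff_eq_rcLimit_false_of_lt_rcCriticalProb (hq : 1 ≤ q) (hp0 : 0 ≤ p)
    (hlt : p < rcCriticalProb d q) : FKGibbs d p q P ↔ P = rcLimit d false p q :=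
  fkGibbs_iff_eq_rcLimit_false_of_thetaWired_eq_zero ⟨hp0, hlt.le.trans (rcCriticalProb_mem_Icc d q).2⟩ hq
    (thetaWired_eq_zero_of_lt_rcCriticalProb hq hp0 hlt)

/-- `h⁰(p,q) = h¹(p,q)` throughout the subcritical phase. [cite: Grimmett2006, §5.2 (𝒟_q ∩ [0,p_c(q)) = ∅, p. 102)] -/
theorem freeEdgeDensity_eq_wiredEdgeDensity_of_lt_rcCriticalProb (hq : 1 ≤ q) (hp0 : 0 ≤ p)
    (hlt : p < rcCriticalProb d q) {e : Sym2 (Site d)} (he : e ∈ (zdGraph d).edgeSet) :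
    freeEdgeDensity d p q e = wiredEdgeDensity d p q e :=
  freeEdgeDensity_eq_wiredEdgeDensity_of_thetaWired_eq_zero ⟨hp0, hlt.le.trans (rcCriticalProb_mem_Icc d q).2⟩ hq
    (thetaWired_eq_zero_of_lt_rcCriticalProb hq hp0 hlt) he

/-- **`𝒟_q ∩ [0, p_c(q)) = ∅`**: a parameter `p ∈ [0,1]` of phase coexistence (`φ⁰_{p,q} ≠ φ¹_{p,q}`) lies
at or above the critical point. [cite: Grimmett2006, §5.2, paragraph after Thm. (5.16) (p. 102)] -/
theorem rcCriticalProb_le_of_rcLimit_false_ne_rcLimit_true (hp : p ∈ Set.Icc (0 : ℝ) 1) (hq : 1 ≤ q)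
    (hne : rcLimit d false p q ≠ rcLimit d true p q) : rcCriticalProb d q ≤ p :=
  le_of_not_gt fun hlt => hne (rcLimit_false_eq_rcLimit_true_of_lt_rcCriticalProb hq hp.1 hlt)

/-! ### At the critical point: `T_W(q)`, `T_F(q)`, `T_U(q)` and uniqueness of the critical measure -/

/-- **Conj. (5.34)(ii), the "if" direction (a theorem): continuity of the wired percolation probability
at `p_c(q)` forces a UNIQUE infinite-volume random-cluster measure at `p_c(q)`** —
`T_W(q) ⇒ φ⁰_{p_c(q),q} = φ¹_{p_c(q),q}` (`q ≥ 1`, every `d`). [cite: Grimmett2006, Conj. (5.34)(ii) with Thm. (5.33)(a)] -/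
theorem rcLimit_false_eq_rcLimit_true_of_fkContinuityWired (hq : 1 ≤ q) (h : FKContinuityWired d q) :
    rcLimit d false (rcCriticalProb d q) q = rcLimit d true (rcCriticalProb d q) q :=
  rcLimit_false_eq_rcLimit_true_of_thetaWired_eq_zero (rcCriticalProb_mem_Icc d q) hq h

/-- Under `T_W(q)` the critical sandwich class is the singleton `{φ⁰_{p_c(q),q}}`.
[cite: Grimmett2006, Conj. (5.34)(ii) with Thm. (5.33)(a)] -/
theorem fkGibbs_iff_eq_rcLimit_false_of_fkContinuityWired (hq : 1 ≤ q) (h : FKContinuityWired d q) :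
    FKGibbs d (rcCriticalProb d q) q P ↔ P = rcLimit d false (rcCriticalProb d q) q :=
  fkGibbs_iff_eq_rcLimit_false_of_thetaWired_eq_zero (rcCriticalProb_mem_Icc d q) hq h

/-- Under `T_W(q)` the edge densities are continuous at `p_c(q)` in the sense `h⁰(p_c,q) = h¹(p_c,q)`
(no jump of the energy density at criticality). [cite: Grimmett2006, Thm. (4.63) with Conj. (5.34)(ii) / Thm. (5.33)(a)] -/
theorem freeEdgeDensity_eq_wiredEdgeDensity_of_fkContinuityWired (hq : 1 ≤ q) (h : FKContinuityWired d q)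
    {e : Sym2 (Site d)} (he : e ∈ (zdGraph d).edgeSet) :
    freeEdgeDensity d (rcCriticalProb d q) q e = wiredEdgeDensity d (rcCriticalProb d q) q e :=
  freeEdgeDensity_eq_wiredEdgeDensity_of_thetaWired_eq_zero (rcCriticalProb_mem_Icc d q) hq h he

/-- **Phase coexistence at `p_c(q)` forces a discontinuous (first-order) wired transition**:
`φ⁰_{p_c,q} ≠ φ¹_{p_c,q} ⇒ θ¹(p_c(q),q) > 0` (so `T_W(q)` fails; the mechanism of Thm. (7.33) at large `q`).
[cite: Grimmett2006, Thm. (5.33)(a), Conj. (5.34), Thm. (7.33)(b)(c)] -/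
theorem thetaWired_rcCriticalProb_pos_of_rcLimit_false_ne_rcLimit_true (hq : 1 ≤ q)
    (hne : rcLimit d false (rcCriticalProb d q) q ≠ rcLimit d true (rcCriticalProb d q) q) :
    0 < thetaWired d (rcCriticalProb d q) q :=
  thetaWired_pos_of_rcLimit_false_ne_rcLimit_true (rcCriticalProb_mem_Icc d q) hq hne

/-- **`T_W(q) ⟺ T_F(q) ∧ φ⁰_{p_c(q),q} = φ¹_{p_c(q),q}`** (`q ≥ 1`, every `d`): wired continuity at `p_c(q)`
is exactly free non-percolation at `p_c(q)` together with uniqueness of the critical infinite-volume measure.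
"⇐": `θ¹(p_c,q) = φ¹_{p_c,q}(0 ↔ ∞) = φ⁰_{p_c,q}(0 ↔ ∞) = θ⁰(p_c,q) = 0` (FO-07's θ-identification).
[cite: Grimmett2006, Thm. (5.16)(c), Thm. (5.33)(a), Conj. (5.34)(ii)] -/
theorem fkContinuityWired_iff_free_and_rcLimit_eq (hq : 1 ≤ q) :
    FKContinuityWired d q ↔ FKContinuityFree d q ∧
      rcLimit d false (rcCriticalProb d q) q = rcLimit d true (rcCriticalProb d q) q := by
  refine ⟨fun h => ⟨free_of_wired hq h, rcLimit_false_eq_rcLimit_true_of_fkContinuityWired hq h⟩,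
    fun ⟨hF, hEq⟩ => ?_⟩
  have hpc := rcCriticalProb_mem_Icc d q
  show thetaWired d (rcCriticalProb d q) q = 0
  rw [← rcLimit_true_real_percolatesAt hpc hq, ← hEq, rcLimit_false_real_percolatesAt hpc hq]
  exact hF

/-- **The cell's transfer residual is uniqueness of the critical measure**: `T_U(q)` (`T_F(q) ⇒ T_W(q)`,
FO-01 `FKTransferAtCritical`) holds iff free non-percolation at `p_c(q)` forces `φ⁰_{p_c(q),q} = φ¹_{p_c(q),q}`
(for `q ∈ (1,2)` on `ℤ³` this is the open Question 4 of Raoufi 2020). [cite: Grimmett2006, Thm. (5.16)(c), Thm. (5.33)(a)] [cite: Raoufi2020, Question 4] -/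
theorem fkTransferAtCritical_iff (hq : 1 ≤ q) :
    FKTransferAtCritical d q ↔
      (FKContinuityFree d q → rcLimit d false (rcCriticalProb d q) q = rcLimit d true (rcCriticalProb d q) q) :=
  ⟨fun hT hF => rcLimit_false_eq_rcLimit_true_of_fkContinuityWired hq (hT hF),
    fun h hF => (fkContinuityWired_iff_free_and_rcLimit_eq hq).2 ⟨hF, h hF⟩⟩

/-- Under `T_W(q)` every measure of the critical sandwich class has almost surely no infinite cluster AND
equals `φ⁰_{p_c(q),q}`: the critical state is unique and does not percolate. [cite: Grimmett2006, Conj. (5.34)(ii) with Thm. (5.33)(a) and (4.21)] -/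
theorem FKGibbs.eq_rcLimit_false_and_percolatesAt_of_fkContinuityWired (hq : 1 ≤ q) (h : FKContinuityWired d q)
    (hP : FKGibbs d (rcCriticalProb d q) q P) :
    P = rcLimit d false (rcCriticalProb d q) q ∧ ∀ x : Site d, P.real (percolatesAt x) = 0 :=
  ⟨hP.eq_rcLimit_false_of_thetaWired_eq_zero (rcCriticalProb_mem_Icc d q) hq h,
    fun x => hP.real_percolatesAt_eq_zero_of_thetaWired_eq_zero (rcCriticalProb_mem_Icc d q) (one_pos.trans_le hq) h x⟩

end Summit.CriticalPhenomena.PercolationContinuityZ3.Theorems.FK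

end
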